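import Summits.AtomisticToContinuum.Crystallization.Theorems.PhononSlackCertificatesPeriodicGivenLayeredLayerCake3
import Summits.AtomisticToContinuum.Crystallization.Theorems.PhononSlackCertificatesPeriodicGivenLayeredLayerCake1
import Literature.MathematicalPhysics.StatisticalMechanics.BarlowStackingEnergy

/-!
# `PricedLinkCensus.StackingHinge` (stmt-AtomisticToContinuum-14993), line `Sketch`, stub `stub_ljSummable`:
# summability of `k ↦ k · |J_k(a, h)|` for the Lennard-Jones interlayer couplings on the box

Conjunct 1 of item 3063 (`LjRegistryDomination`). On the box
`B = {47/50 ≤ a ≤ 1, 39a/50 ≤ h ≤ 17a/20}` the Lennard-Jones interlayer registry coupling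
`J_k(a, h) = barlowCoupling lennardJones a h k = Φ_A(k) − Φ_N(k)` satisfies `Σ_k k |J_k| < ∞`.

Proof: the layer sums at layer distance `k` and height `h` are the layer sums at layer distance `1` and
height `k h` (`ljs_layerInteraction_height`, a coordinate identity of `layerVec`); the landed decay
`|layerInteraction lennardJones a H δ 1| ≤ 192 / H⁴` for `a ∈ [47/50, 1]`, `|H| ≥ 7/10`
(`LayeredHull.cake_abs_layerInteraction_le`) then gives `|J_k| ≤ 384 / (k h)⁴` for `k ≥ 1` (on the box
`h ≥ 39/50 · 47/50 > 7/10`), so `k |J_k| ≤ (384 / h⁴) k⁻³`, a convergent `p`-series.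
-/

namespace Summit.AtomisticToContinuum.Crystallization.Theorems.PricedHcpWindowsLjSummable

open Literature.MathematicalPhysics.StatisticalMechanics
open Summit.AtomisticToContinuum.Crystallization.Theorems.LayeredHull

/-- Reindexing of the layer vectors: layer distance `k` at height `h` is layer distance `1` at height
`k h` (same vector, `k • (h e₃) = 1 • ((k h) e₃)`), at the level of norms. [folklore] -/
theorem ljs_norm_layerVec_height (a h : ℝ) (δ k i j : ℤ) :
    ‖layerVec a h δ k i j‖ = ‖layerVec a ((k : ℝ) * h) δ 1 i j‖ := by
  rw [norm_layerVec, norm_layerVec]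
  congr 1
  push_cast
  ring

/-- Reindexing of the layer interaction: `layerInteraction V a h δ k = layerInteraction V a (k h) δ 1`.
[folklore] -/
theorem ljs_layerInteraction_height (V : ℝ → ℝ) (a h : ℝ) (δ k : ℤ) :
    layerInteraction V a h δ k = layerInteraction V a ((k : ℝ) * h) δ 1 := by
  unfold layerInteraction
  exact tsum_congr fun ij => by rw [ljs_norm_layerVec_height]

/-- Reindexing of the coupling: `J_k(a, h) = Φ_A − Φ_N` of a single layer at height `k h`. [folklore] -/
theorem ljs_barlowCoupling_eq (V : ℝ → ℝ) (a h : ℝ) (k : ℕ) :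
    barlowCoupling V a h k =
      layerInteraction V a ((k : ℝ) * h) 0 1 - layerInteraction V a ((k : ℝ) * h) 1 1 := by
  unfold barlowCoupling
  rw [ljs_layerInteraction_height V a h 0 k, ljs_layerInteraction_height V a h 1 k, Int.cast_natCast]

/-- Decay of the Lennard-Jones coupling: `|J_k(a, h)| ≤ 384 / (k h)⁴` for `a ∈ [47/50, 1]`, `h ≥ 7/10`,
`k ≥ 1` (twice the landed layer decay `192 / H⁴` at `H = k h ≥ 7/10`). [folklore] -/
theorem ljs_abs_barlowCoupling_le (a h : ℝ) (ha : 47 / 50 ≤ a) (ha1 : a ≤ 1) (hh : 7 / 10 ≤ h)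
    (k : ℕ) (hk : 1 ≤ k) :
    |barlowCoupling lennardJones a h k| ≤ 384 / ((k : ℝ) * h) ^ 4 := by
  have hk1 : (1 : ℝ) ≤ k := by exact_mod_cast hk
  have hh0 : 0 ≤ h := by linarith
  have hk0 : (0 : ℝ) ≤ k := by linarith
  have hH : 7 / 10 ≤ |(k : ℝ) * h| := by
    rw [abs_of_nonneg (mul_nonneg hk0 hh0)]
    nlinarith [mul_nonneg (sub_nonneg.2 hk1) hh0]
  have h0 := cake_abs_layerInteraction_le a ((k : ℝ) * h) ha ha1 hH 0
  have h1 := cake_abs_layerInteraction_le a ((k : ℝ) * h) ha ha1 hH 1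
  rw [ljs_barlowCoupling_eq]
  calc |layerInteraction lennardJones a ((k : ℝ) * h) 0 1 - layerInteraction lennardJones a ((k : ℝ) * h) 1 1|
      ≤ |layerInteraction lennardJones a ((k : ℝ) * h) 0 1| +
          |layerInteraction lennardJones a ((k : ℝ) * h) 1 1| := abs_sub _ _
    _ ≤ 192 / ((k : ℝ) * h) ^ 4 + 192 / ((k : ℝ) * h) ^ 4 := add_le_add h0 h1
    _ = 384 / ((k : ℝ) * h) ^ 4 := by ring

/-- **stub_ljSummable** (conjunct 1 of item 3063).  `Σ_k k·|J_k(a, h)| < ∞` on the box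
`47/50 ≤ a ≤ 1`, `39a/50 ≤ h ≤ 17a/20`: by the reindexing
`layerInteraction V a h δ k = layerInteraction V a (k h) δ 1` and the landed decay
`|layerInteraction lennardJones a H δ 1| ≤ 192/H⁴` (`cake_abs_layerInteraction_le`, `a ∈ [47/50,1]`,
`|H| ≥ 7/10`), `k|J_k| ≤ 384 h⁻⁴ k⁻³` for `k ≥ 1`, and `Σ k⁻³ < ∞`. [folklore] -/
theorem stub_ljSummable : ∀ a h : ℝ, 47 / 50 ≤ a → a ≤ 1 → 39 / 50 * a ≤ h → h ≤ 17 / 20 * a → Summable (fun k : ℕ => (k : ℝ) * |Literature.MathematicalPhysics.StatisticalMechanics.barlowCoupling Literature.MathematicalPhysics.StatisticalMechanics.lennardJones a h k|) := by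
  intro a h ha ha1 hh _
  have hh7 : 7 / 10 ≤ h := by linarith
  have hpos : 0 < h := by linarith
  have hC : Summable fun n : ℕ => 384 / h ^ 4 * (1 / ((n + 1 : ℕ) : ℝ) ^ 3) :=
    ((summable_nat_add_iff (f := fun n : ℕ => 1 / (n : ℝ) ^ 3) 1).2
      (Real.summable_one_div_nat_pow.2 (by norm_num))).mul_left (384 / h ^ 4)
  have key : Summable fun n : ℕ =>
      ((n + 1 : ℕ) : ℝ) * |barlowCoupling lennardJones a h (n + 1)| := by
    refine Summable.of_nonneg_of_le (fun n => mul_nonneg (Nat.cast_nonneg _) (abs_nonneg _))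
      (fun n => ?_) hC
    have hK : (((n + 1 : ℕ) : ℝ)) ≠ 0 := by positivity
    have hb := ljs_abs_barlowCoupling_le a h ha ha1 hh7 (n + 1) (Nat.succ_pos n)
    calc ((n + 1 : ℕ) : ℝ) * |barlowCoupling lennardJones a h (n + 1)|
        ≤ ((n + 1 : ℕ) : ℝ) * (384 / (((n + 1 : ℕ) : ℝ) * h) ^ 4) :=
          mul_le_mul_of_nonneg_left hb (Nat.cast_nonneg _)
      _ = 384 / h ^ 4 * (1 / ((n + 1 : ℕ) : ℝ) ^ 3) := by
          field_simp
  exact (summable_nat_add_iff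
    (f := fun k : ℕ => (k : ℝ) * |barlowCoupling lennardJones a h k|) 1).1 key

end Summit.AtomisticToContinuum.Crystallization.Theorems.PricedHcpWindowsLjSummable
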